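import Summits.ValiantsHypothesis.ValiantsHypothesis.Theorems.BarrierLeverChowCubeSelfDual

/-!
# Route BarrierLever — item 20195, dense regime: THIN ROWS × CO-THIN COLUMNS for every `h`

Helper file (`--supports stmt-ValiantsHypothesis-20195`; cell valiant-natproofs, rung V4, 𝒟-side of
door (c); seat val-np-p2 gen 8).  Closes NO item; definition-free.  First ALL-`h` theorem of the
dense regime (`r = 1 + h + C(h,2)`, the full thin row family) of item 20195 with FAT columns:

**`chow_hit_thin_cothin`** — for every `h` and all injective enumerations `u` of the sets of size
`≤ 2` and `w` of the sets of size `≥ h - 2`, some product of `h + h` affine forms `ℓ` has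
`det[coeff_{E (u i) (w j)} ∏ ℓ] ≠ 0`.

Proof = the cube pipeline of this seat: compressing the co-thin family along `0, 1, …, h-1` gives,
after `k` steps, the family `F_k = {W : |W ∖ [k]| - |W ∩ [k]| ≥ h - 2 - k}` (`image_compress_cothinStage`;
`F_0 =` co-thin, `F_h =` thin), so the chain ends in a permutation of `u` (`range_chain_eq`) and
`…ChowCubeSelfDual.chow_hit_of_chain_to_selfDual` applies (the thin family is closed under removing
elements).  The witness is explicit in shape: the x-private forms `x_a + 1 + Σ_c q_{ac} y_c` at a
suitable table and the cube-type factors `s_c + y_c`.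

WHAT THIS IS NOT: one infinite family of the dense regime; item 20195 stays open; nothing on crux
stmt-ValiantsHypothesis-14610 or on `VP` versus `VNP`.
-/

set_option linter.dupNamespace false

namespace Summit.ValiantsHypothesis.ValiantsHypothesis.Theorems.BarrierLever.ChowCube

open Finset MvPolynomial

variable {h : ℕ}

/-! ## 1. The stages of the co-thin compression -/

/-- **One compression step on the stage families.**  With `K_k = {c : c < k}` and
`F_k = {W : h - 2 - k ≤ |W ∖ K_k| - |W ∩ K_k|}` (integers): compressing `F_k` along the coordinate
`k` gives `F_{k+1}`. -/
theorem image_compress_cothinStage (k : ℕ) (hk : k < h) :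
    ((Finset.univ : Finset (Finset (Fin h))).filter fun W =>
        (h : ℤ) - 2 - k ≤ ((W \ Finset.univ.filter fun c : Fin h => (c : ℕ) < k).card : ℤ) -
          ((W ∩ Finset.univ.filter fun c : Fin h => (c : ℕ) < k).card : ℤ)).image
      (fun W => if (⟨k, hk⟩ : Fin h) ∈ W ∧ W.erase ⟨k, hk⟩ ∉
          ((Finset.univ : Finset (Finset (Fin h))).filter fun W =>
            (h : ℤ) - 2 - k ≤ ((W \ Finset.univ.filter fun c : Fin h => (c : ℕ) < k).card : ℤ) -
              ((W ∩ Finset.univ.filter fun c : Fin h => (c : ℕ) < k).card : ℤ))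
        then W.erase ⟨k, hk⟩ else W) =
    (Finset.univ : Finset (Finset (Fin h))).filter fun W =>
        (h : ℤ) - 2 - (k + 1 : ℕ) ≤ ((W \ Finset.univ.filter fun c : Fin h => (c : ℕ) < k + 1).card : ℤ) -
          ((W ∩ Finset.univ.filter fun c : Fin h => (c : ℕ) < k + 1).card : ℤ) := by
  classical
  set c : Fin h := ⟨k, hk⟩ with hc
  set K : Finset (Fin h) := Finset.univ.filter fun c : Fin h => (c : ℕ) < k with hK
  set K' : Finset (Fin h) := Finset.univ.filter fun c : Fin h => (c : ℕ) < k + 1 with hK'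
  have hcK : c ∉ K := by simp [hK, hc]
  have hK'eq : K' = insert c K := by
    ext x
    simp only [hK', hK, hc, Finset.mem_filter, Finset.mem_univ, true_and, Finset.mem_insert, Fin.ext_iff]
    omega
  -- the stage predicate
  have hF : ∀ W, W ∈ ((Finset.univ : Finset (Finset (Fin h))).filter fun W =>
      (h : ℤ) - 2 - k ≤ ((W \ K).card : ℤ) - ((W ∩ K).card : ℤ)) ↔
      (h : ℤ) - 2 - k ≤ ((W \ K).card : ℤ) - ((W ∩ K).card : ℤ) := by
    intro W; simp
  -- card bookkeeping
  have hd_erase : ∀ W, c ∈ W → (((W.erase c) \ K).card : ℤ) - (((W.erase c) ∩ K).card : ℤ) =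
      ((W \ K).card : ℤ) - ((W ∩ K).card : ℤ) - 1 := by
    intro W hcW
    have h1 : (W.erase c) \ K = (W \ K).erase c := by
      ext x; simp only [Finset.mem_sdiff, Finset.mem_erase]; tauto
    have h2 : (W.erase c) ∩ K = W ∩ K := by
      ext x; simp only [Finset.mem_inter, Finset.mem_erase]
      constructor
      · rintro ⟨⟨-, hx⟩, hxK⟩; exact ⟨hx, hxK⟩
      · rintro ⟨hx, hxK⟩; exact ⟨⟨fun e => hcK (e ▸ hxK), hx⟩, hxK⟩
    have hmem : c ∈ W \ K := Finset.mem_sdiff.mpr ⟨hcW, hcK⟩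
    rw [h1, h2, Finset.card_erase_of_mem hmem]
    have := Finset.card_pos.mpr ⟨c, hmem⟩
    omega
  have hd' : ∀ W, ((W \ K').card : ℤ) - ((W ∩ K').card : ℤ) =
      if c ∈ W then ((W \ K).card : ℤ) - ((W ∩ K).card : ℤ) - 2
      else ((W \ K).card : ℤ) - ((W ∩ K).card : ℤ) := by
    intro W
    rw [hK'eq]
    by_cases hcW : c ∈ W
    · rw [if_pos hcW]
      have h1 : W \ insert c K = (W \ K).erase c := by
        ext x; simp only [Finset.mem_sdiff, Finset.mem_insert, Finset.mem_erase]; tauto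
      have h2 : W ∩ insert c K = insert c (W ∩ K) := by
        ext x; simp only [Finset.mem_inter, Finset.mem_insert]
        constructor
        · rintro ⟨hx, hx' | hx'⟩
          · exact Or.inl hx'
          · exact Or.inr ⟨hx, hx'⟩
        · rintro (hx | ⟨hx, hx'⟩)
          · exact ⟨hx ▸ hcW, Or.inl hx⟩
          · exact ⟨hx, Or.inr hx'⟩
      have hmem : c ∈ W \ K := Finset.mem_sdiff.mpr ⟨hcW, hcK⟩
      have hnot : c ∉ W ∩ K := fun hh => hcK (Finset.mem_inter.mp hh).2
      rw [h1, h2, Finset.card_erase_of_mem hmem, Finset.card_insert_of_notMem hnot]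
      have := Finset.card_pos.mpr ⟨c, hmem⟩
      push_cast
      omega
    · rw [if_neg hcW]
      have h1 : W \ insert c K = W \ K := by
        ext x; simp only [Finset.mem_sdiff, Finset.mem_insert]
        constructor
        · rintro ⟨hx, hx'⟩; exact ⟨hx, fun hh => hx' (Or.inr hh)⟩
        · rintro ⟨hx, hx'⟩; exact ⟨hx, fun hh => hh.elim (fun e => hcW (e ▸ hx)) hx'⟩
      have h2 : W ∩ insert c K = W ∩ K := by
        ext x; simp only [Finset.mem_inter, Finset.mem_insert]
        constructor
        · rintro ⟨hx, hx' | hx'⟩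
          · exact absurd (hx' ▸ hx) hcW
          · exact ⟨hx, hx'⟩
        · rintro ⟨hx, hx'⟩; exact ⟨hx, Or.inr hx'⟩
      rw [h1, h2]
  -- the claimed identity, by membership
  ext V
  rw [Finset.mem_image, Finset.mem_filter]
  simp only [Finset.mem_univ, true_and]
  have hcast : ((k + 1 : ℕ) : ℤ) = (k : ℤ) + 1 := by push_cast; ring
  rw [hcast, hd']
  constructor
  · rintro ⟨W, hW, hWV⟩
    rw [Finset.mem_filter] at hW
    have hWd : (h : ℤ) - 2 - k ≤ ((W \ K).card : ℤ) - ((W ∩ K).card : ℤ) := hW.2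
    by_cases hmove : c ∈ W ∧ W.erase c ∉ ((Finset.univ : Finset (Finset (Fin h))).filter fun W =>
        (h : ℤ) - 2 - k ≤ ((W \ K).card : ℤ) - ((W ∩ K).card : ℤ))
    · rw [if_pos hmove] at hWV
      rw [← hWV, if_neg (Finset.notMem_erase c W), hd_erase W hmove.1]
      omega
    · rw [if_neg hmove] at hWV
      subst hWV
      by_cases hcW : c ∈ W
      · rw [if_pos hcW]
        have hstay : W.erase c ∈ ((Finset.univ : Finset (Finset (Fin h))).filter fun W =>
            (h : ℤ) - 2 - k ≤ ((W \ K).card : ℤ) - ((W ∩ K).card : ℤ)) := by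
          by_contra hh; exact hmove ⟨hcW, hh⟩
        rw [hF, hd_erase W hcW] at hstay
        omega
      · rw [if_neg hcW]
        omega
  · intro hV
    by_cases hcV : c ∈ V
    · rw [if_pos hcV] at hV
      refine ⟨V, Finset.mem_filter.mpr ⟨Finset.mem_univ _, by omega⟩, ?_⟩
      rw [if_neg]
      rintro ⟨-, hh⟩
      apply hh
      rw [hF, hd_erase V hcV]
      omega
    · rw [if_neg hcV] at hV
      by_cases htight : (h : ℤ) - 2 - k ≤ ((V \ K).card : ℤ) - ((V ∩ K).card : ℤ)
      · refine ⟨V, Finset.mem_filter.mpr ⟨Finset.mem_univ _, htight⟩, ?_⟩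
        rw [if_neg]
        rintro ⟨hh, -⟩
        exact hcV hh
      · -- `V` comes from `insert c V`, which is tight
        have hdins : (((insert c V) \ K).card : ℤ) - (((insert c V) ∩ K).card : ℤ) =
            ((V \ K).card : ℤ) - ((V ∩ K).card : ℤ) + 1 := by
          have := hd_erase (insert c V) (Finset.mem_insert_self c V)
          rw [Finset.erase_insert hcV] at this
          omega
        refine ⟨insert c V, Finset.mem_filter.mpr ⟨Finset.mem_univ _, by omega⟩, ?_⟩
        rw [if_pos, Finset.erase_insert hcV]
        refine ⟨Finset.mem_insert_self c V, ?_⟩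
        rw [Finset.erase_insert hcV, hF]
        exact htight


/-! ## 2. Indexed compression chains and their ranges -/

/-- One indexed compression step acts on the range by the set-level compression. -/
theorem image_chain_step {r : ℕ} (wk wk1 : Fin r → Finset (Fin h)) (c : Fin h)
    (hstep : ∀ j, wk1 j = if c ∈ wk j ∧ (∀ j', wk j' ≠ (wk j).erase c) then (wk j).erase c else wk j) :
    (Finset.univ : Finset (Fin r)).image wk1 =
      ((Finset.univ : Finset (Fin r)).image wk).image
        (fun W => if c ∈ W ∧ W.erase c ∉ (Finset.univ : Finset (Fin r)).image wk then W.erase c else W) := by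
  classical
  have hcond : ∀ j, (∀ j', wk j' ≠ (wk j).erase c) ↔ (wk j).erase c ∉ (Finset.univ : Finset (Fin r)).image wk := by
    intro j
    rw [Finset.mem_image]
    constructor
    · rintro hall ⟨j', -, hj'⟩
      exact hall j' hj'
    · intro hno j' hj'
      exact hno ⟨j', Finset.mem_univ _, hj'⟩
  ext V
  constructor
  · intro hV
    obtain ⟨j, -, hj⟩ := Finset.mem_image.mp hV
    refine Finset.mem_image.mpr ⟨wk j, Finset.mem_image.mpr ⟨j, Finset.mem_univ _, rfl⟩, ?_⟩
    rw [← hj, hstep j]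
    by_cases hc : c ∈ wk j ∧ ∀ j', wk j' ≠ (wk j).erase c
    · rw [if_pos hc, if_pos ⟨hc.1, (hcond j).mp hc.2⟩]
    · rw [if_neg hc, if_neg (fun hh => hc ⟨hh.1, (hcond j).mpr hh.2⟩)]
  · intro hV
    obtain ⟨W, hW, hWV⟩ := Finset.mem_image.mp hV
    obtain ⟨j, -, rfl⟩ := Finset.mem_image.mp hW
    refine Finset.mem_image.mpr ⟨j, Finset.mem_univ _, ?_⟩
    rw [hstep j, ← hWV]
    by_cases hc : c ∈ wk j ∧ ∀ j', wk j' ≠ (wk j).erase c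
    · rw [if_pos hc, if_pos ⟨hc.1, (hcond j).mp hc.2⟩]
    · rw [if_neg hc, if_neg (fun hh => hc ⟨hh.1, (hcond j).mpr hh.2⟩)]

/-! ## 3. Thin rows × co-thin columns -/

/-- **THIN × CO-THIN (every `h`).**  For injective enumerations `u` of the sets of size `≤ 2` and `w`
of the sets of size `≥ h - 2` (both of length `1 + h + C(h,2)`), some product of `h + h` affine
forms `ℓ` has `det[coeff_{E (u i) (w j)} ∏ ℓ] ≠ 0`. -/
theorem chow_hit_thin_cothin {r : ℕ} (u w : Fin r → Finset (Fin h)) (hu : Function.Injective u)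
    (hw : Function.Injective w) (hU : ∀ S : Finset (Fin h), (∃ i, u i = S) ↔ S.card ≤ 2)
    (hW : ∀ S : Finset (Fin h), (∃ j, w j = S) ↔ h - 2 ≤ S.card) :
    ∃ ℓ : Fin (h + h) → MvPolynomial (Fin (h + h)) ℂ, (∀ k, (ℓ k).totalDegree ≤ 1) ∧
      (Matrix.of fun i j : Fin r => coeff
        (∑ a ∈ u i, Finsupp.single (Fin.castAdd h a) 1 + ∑ c ∈ w j, Finsupp.single (Fin.natAdd h c) 1)
        (∏ k, ℓ k)).det ≠ 0 := by
  classical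
  -- the chain along `0, 1, …, h-1`
  set L : List (Fin h) := List.finRange h with hL
  have hLnodup : L.Nodup := List.nodup_finRange h
  have hLall : ∀ c, c ∈ L := fun c => List.mem_finRange c
  have hLlen : L.length = h := List.length_finRange
  let step : ℕ → (Fin r → Finset (Fin h)) → (Fin r → Finset (Fin h)) := fun k wk j =>
    if hk : k < h then
      (if (⟨k, hk⟩ : Fin h) ∈ wk j ∧ (∀ j', wk j' ≠ (wk j).erase ⟨k, hk⟩) then (wk j).erase ⟨k, hk⟩
        else wk j)
    else wk j
  let ws : ℕ → (Fin r → Finset (Fin h)) := fun k =>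
    Nat.rec (motive := fun _ => Fin r → Finset (Fin h)) w (fun k wk => step k wk) k
  have hws0 : ws 0 = w := rfl
  have hwsS : ∀ k, ws (k + 1) = step k (ws k) := fun k => rfl
  have hstep : ∀ k (hk : k < L.length) j, ws (k + 1) j =
      if L[k] ∈ ws k j ∧ (∀ j', ws k j' ≠ (ws k j).erase L[k]) then (ws k j).erase L[k] else ws k j := by
    intro k hk j
    have hk' : k < h := by rw [hLlen] at hk; exact hk
    have hLk : L[k] = ⟨k, hk'⟩ := by simp [hL, List.getElem_finRange]
    rw [hwsS, hLk]
    show step k (ws k) j = _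
    simp only [step, dif_pos hk']
  -- the ranges are the stage families
  have hstage : ∀ k, k ≤ h → (Finset.univ : Finset (Fin r)).image (ws k) =
      (Finset.univ : Finset (Finset (Fin h))).filter fun W =>
        (h : ℤ) - 2 - k ≤ ((W \ Finset.univ.filter fun c : Fin h => (c : ℕ) < k).card : ℤ) -
          ((W ∩ Finset.univ.filter fun c : Fin h => (c : ℕ) < k).card : ℤ) := by
    intro k
    induction k with
    | zero =>
      intro _
      ext W
      have hK0 : (Finset.univ.filter fun c : Fin h => (c : ℕ) < 0) = ∅ := by
        ext c; simp
      rw [Finset.mem_filter, Finset.mem_image, hK0, Finset.sdiff_empty, Finset.inter_empty,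
        Finset.card_empty]
      simp only [Finset.mem_univ, true_and, Nat.cast_zero, sub_zero]
      rw [hws0, hW W]
      omega
    | succ k ih =>
      intro hk
      have hk' : k < h := Nat.lt_of_succ_le hk
      rw [image_chain_step (ws k) (ws (k + 1)) ⟨k, hk'⟩ (fun j => by
        have e := hstep k (by rw [hLlen]; exact hk') j
        have hLk : L[k] = ⟨k, hk'⟩ := by simp [hL, List.getElem_finRange]
        rw [hLk] at e
        exact e), ih hk'.le]
      exact image_compress_cothinStage k hk'
  -- the end of the chain is the thin family
  have hend_range : (Finset.univ : Finset (Fin r)).image (ws h) = (Finset.univ : Finset (Fin r)).image u := by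
    rw [hstage h le_rfl]
    ext W
    have hKh : (Finset.univ.filter fun c : Fin h => (c : ℕ) < h) = Finset.univ := by
      ext c; simp
    have hWu : W \ (Finset.univ : Finset (Fin h)) = ∅ :=
      Finset.sdiff_eq_empty_iff_subset.mpr (Finset.subset_univ W)
    rw [Finset.mem_filter, Finset.mem_image, hKh, hWu, Finset.inter_univ, Finset.card_empty]
    simp only [Finset.mem_univ, true_and, Nat.cast_zero, zero_sub]
    rw [hU W]
    omega
  have hex : ∀ j, ∃ i, u i = ws h j := by
    intro j
    have : ws h j ∈ (Finset.univ : Finset (Fin r)).image u := by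
      rw [← hend_range]
      exact Finset.mem_image.mpr ⟨j, Finset.mem_univ _, rfl⟩
    obtain ⟨i, -, hi⟩ := Finset.mem_image.mp this
    exact ⟨i, hi⟩
  choose g hg using hex
  have hinjh : Function.Injective (ws h) := by
    have := chain_injective L ws (by rw [hws0]; exact hw) hstep
    rw [hLlen] at this
    exact this
  have hginj : Function.Injective g := fun j j' e => hinjh (by rw [← hg j, ← hg j', e])
  set σ : Equiv.Perm (Fin r) := Equiv.ofBijective g (Finite.injective_iff_bijective.mp hginj) with hσ
  have hend : ∀ j, ws L.length j = u (σ j) := by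
    intro j
    rw [hLlen, hσ, Equiv.ofBijective_apply, hg]
  -- the thin family is closed under removing elements
  have hcard : ∀ i, (u i).card ≤ 2 := fun i => (hU (u i)).mp ⟨i, rfl⟩
  have hcl : ∀ i, ∀ c ∈ u i, ∃ i', u i' = (u i).erase c := by
    intro i c hc
    exact (hU _).mpr ((Finset.card_erase_le).trans (hcard i))
  exact chow_hit_of_chain_to_selfDual u w hu hcard hcl hw L hLnodup hLall ws hws0 hstep σ hend

end Summit.ValiantsHypothesis.ValiantsHypothesis.Theorems.BarrierLever.ChowCube
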